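import Summits.ResolutionOfSingularities.ResolutionOfSingularities.Theorems.PurelyInseparableDim4ResConeLossyTiltFreePeel
import Summits.ResolutionOfSingularities.ResolutionOfSingularities.Theorems.PurelyInseparableDim4ResConeLayer
import Mathlib.RingTheory.Coprime.Lemmas
import Mathlib.Algebra.Polynomial.Div
import HarnessLib
import HarnessLib.Audit.Tags

/-!
# Purely inseparable four-folds — the ROW LEMMA (RL), kernel form: a row that is both a multiple of the
# translated boundary unit and of a high chart power is zero (K2(p) lane, brick K29a; cell `res-dim4-pi`)

[OURS · counted 0 · cell `res-dim4-pi` · K2(p) lane holder res-dim4-p-12 g3's brick K29a «ResConeContactSurfaceRows»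
by signature (bus 2026-08-29 03:09Z); the lemma and its proof res-dim4-idea-4 g4 (memo CONTACT-SURFACE.md §9 (RL),
03:07Z); letters res-dim4-p-5 g4's FILE 1a `…ResConeLossyTiltFreePeel` (p692165); seat res-dim4-p-9 g3.]  Nothing here
proves K2(p)/K2(5), `NoIsolatedTrap p p` or resolution of singularities in dimension ≥ 4 / characteristic `p`.

idea-4's (RL): at an immediate lose-both (`τ ≠ 0`) → satellite pair, the `V^i`-row of level `ℓ` at the free point is
`(w₁ + τ)^{r_w} · R^{(ℓ)}_{ℓ+i}(1, w₁ + τ)` (degree `≤ ℓ + i + r_w`), S-legality makes it divisible by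
`w₁^{2ℓ+1−2i}`, the two divisors are coprime, hence the row vanishes unless `3i ≥ ℓ + 1`.  This file is the KERNEL of
that argument, general in every parameter (any field, any exponents, any letters `a ≠ a′` of `Fin 4`, the other two
inert), in two dresses:
* §1 the one-variable shadow **`eq_zero_of_X_pow_dvd_linear_pow_mul`**: `τ ≠ 0`, `X^s ∣ (X + C τ)^r · Q`,
  `natDegree Q < s` ⇒ `Q = 0` (`IsCoprime X (X + C τ)`, powers, cancel, degree);
* §2 the row form in res-dim4-p-5 g4's letters **`row_eq_zero_of_short_legal_row`**: if on the row
  `{e : e_a + e_{a′} = D, inert part κ}` (shifted by the boundary `x_a^{α+β}`) the product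
  `x_a^α (x_{a′} + t x_a)^β · shear_a^{t e_{a′}} G` has no monomial with `e_{a′} < N`, and the row is SHORT (`D < N`),
  then `G` vanishes on the row — `peel` (the unit's lowest `x_{a′}`-power is `t^β x_a^β ≠ 0`) + shortness +
  `row_coeff_eq_zero_of_shear` (the shear is unitriangular on rows); **`row_eq_zero_of_short_legal_row_shear`** is the
  same with the hypothesis on `shear (x_a^α x_{a′}^β · G)`; `level_row_arith` is the numerology `3i ≤ ℓ ⇒
  ℓ + i < 2ℓ + 1 − 2i` that makes the level-`ℓ`, `V^i` row short under S-legality.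
The chain-level dress (which rows of which state, `α, β = r_U, r_w`, `N` from S-legality with `C₂` on the H-tail) is
the D∞ brick's FILE 2 business and imports this kernel by name.

bears_on: LADDER-RESOLUTION:D157-DOOR2 (res-dim4-pi · K2(p) · K29a row lemma, kernel).  Supports
stmt-ResolutionOfSingularities-16155 (helper).
-/

set_option linter.dupNamespace false -- mandated namespace of this single-conjunct summit

noncomputable section

namespace Summit.ResolutionOfSingularities.ResolutionOfSingularities.Theorems.PIDim4

namespace ResCone

open MvPolynomial Finset
open Literature.AlgebraicGeometry.Resolution
open Literature.AlgebraicGeometry.Resolution.CentreBlowup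
open Literature.AlgebraicGeometry.Resolution.Hauser2010

variable {K : Type} [Field K]

/-! ## 1. The one-variable shadow -/

/-- `X` and `X + C τ` are coprime for `τ ≠ 0`. [folklore] -/
theorem isCoprime_X_X_add_C {τ : K} (hτ : τ ≠ 0) :
    IsCoprime (Polynomial.X : Polynomial K) (Polynomial.X + Polynomial.C τ) := by
  refine ⟨-Polynomial.C τ⁻¹, Polynomial.C τ⁻¹, ?_⟩
  rw [mul_add, ← Polynomial.C_mul, inv_mul_cancel₀ hτ, Polynomial.C_1]
  ring

/-- **(RL), one-variable shadow.**  If `τ ≠ 0`, `X^s ∣ (X + C τ)^r · Q` and `natDegree Q < s`, then `Q = 0`: the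
chart power and the translated boundary unit are coprime, so `X^s ∣ Q`. [OURS] [folklore] -/
theorem eq_zero_of_X_pow_dvd_linear_pow_mul {τ : K} (hτ : τ ≠ 0) {r s : ℕ} {Q : Polynomial K}
    (hdvd : Polynomial.X ^ s ∣ (Polynomial.X + Polynomial.C τ) ^ r * Q) (hdeg : Q.natDegree < s) : Q = 0 := by
  have hcop : IsCoprime ((Polynomial.X : Polynomial K) ^ s) ((Polynomial.X + Polynomial.C τ) ^ r) :=
    (isCoprime_X_X_add_C hτ).pow
  have hQ : Polynomial.X ^ s ∣ Q := hcop.dvd_of_dvd_mul_left hdvd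
  exact Polynomial.eq_zero_of_dvd_of_natDegree_lt hQ (by rwa [Polynomial.natDegree_X_pow])

/-! ## 2. The row form -/

/-- Decomposition of an exponent on the row `{e_a + e_{a′} = D}` as a row monomial with inert offset.
[folklore] -/
theorem eq_rowExp_add_erase {a a' : Fin 4} (haa : a ≠ a') {e : Fin 4 →₀ ℕ} {D : ℕ} (hD : e a + e a' = D) :
    e = Finsupp.single a (D - e a') + Finsupp.single a' (e a') + (e.erase a).erase a' := by
  ext i
  rw [rowExp_add_apply haa (by rw [Finsupp.erase_ne haa, Finsupp.erase_same])
    (by rw [Finsupp.erase_same])]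
  by_cases hia : i = a
  · rw [if_pos hia, hia]; omega
  · rw [if_neg hia]
    by_cases hia' : i = a'
    · rw [if_pos hia', hia']
    · rw [if_neg hia', Finsupp.erase_ne hia', Finsupp.erase_ne hia]

/-- **(RL), row form — the KERNEL of idea-4's ROW LEMMA in res-dim4-p-5 g4's letters.**  Let `a ≠ a′`, `t ≠ 0`,
and consider the row `{e : e_a + e_{a′} = D, e_i = κ_i for the inert i}`.  If the product
`x_a^α (x_{a′} + t x_a)^β · shear_a^{t e_{a′}} G` has NO monomial `x^{e + (α+β) e_a}` with `e` on the row and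
`e_{a′} < N` («S-legality»), and the row is SHORT, `D < N`, then `G` VANISHES on the row.  (`peel`: the row of
`shear G` has no `e_{a′} < N`; shortness: it is empty; `row_coeff_eq_zero_of_shear`: so is the row of `G`.)
[OURS] [cite: Hauser2010, §I (definition of P⁺)] -/
theorem row_eq_zero_of_short_legal_row {a a' : Fin 4} (haa : a ≠ a') {t : K} (ht : t ≠ 0) (α β : ℕ)
    (G : MvPolynomial (Fin 4) K) (D : ℕ) (κ : Fin 4 → ℕ) (N : ℕ) (hDN : D < N)
    (h : ∀ e : Fin 4 →₀ ℕ, e a + e a' = D → (∀ i, i ≠ a → i ≠ a' → e i = κ i) → e a' < N →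
      coeff (e + Finsupp.single a (α + β)) ((∑ l ∈ Finset.range (β + 1),
        monomial (Finsupp.single a (α + l) + Finsupp.single a' (β - l)) (((β.choose l : ℕ) : K) * t ^ l)) *
          shear a (Pi.single a' t) G) = 0) :
    ∀ e : Fin 4 →₀ ℕ, e a + e a' = D → (∀ i, i ≠ a → i ≠ a' → e i = κ i) → coeff e G = 0 := by
  have hrow := peel haa ht α β (shear a (Pi.single a' t) G) D κ N h
  intro e hD hκ
  set μ₀ : Fin 4 →₀ ℕ := (e.erase a).erase a' with hμ₀
  have hμa : μ₀ a = 0 := by rw [hμ₀, Finsupp.erase_ne haa, Finsupp.erase_same]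
  have hμa' : μ₀ a' = 0 := by rw [hμ₀, Finsupp.erase_same]
  have hμi : ∀ i, i ≠ a → i ≠ a' → μ₀ i = κ i := fun i hia hia' => by
    rw [hμ₀, Finsupp.erase_ne hia', Finsupp.erase_ne hia, hκ i hia hia']
  -- the whole row of `shear G` vanishes (it is shorter than the legality bound)
  have hshear : ∀ j, j ≤ D →
      coeff (Finsupp.single a (D - j) + Finsupp.single a' j + μ₀) (shear a (Pi.single a' t) G) = 0 := by
    intro j hj
    refine hrow _ ?_ (fun i hia hia' => ?_) ?_
    · rw [rowExp_add_apply haa hμa hμa', rowExp_add_apply haa hμa hμa', if_pos rfl, if_neg haa.symm,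
        if_pos rfl]; omega
    · rw [rowExp_add_apply haa hμa hμa', if_neg hia, if_neg hia', hμi i hia hia']
    · rw [rowExp_add_apply haa hμa hμa', if_neg haa.symm, if_pos rfl]; omega
  have hG := row_coeff_eq_zero_of_shear haa t G D hμa hμa' hshear (e a') (by omega)
  rw [eq_rowExp_add_erase haa hD]
  exact hG

/-- **(RL), row form on the sheared boundary product.**  The same with the legality hypothesis stated on
`shear_a^{t e_{a′}} (x_a^α x_{a′}^β · G) = x_a^α (x_{a′} + t x_a)^β · shear G` — the lose-both model
`…LossyTiltFreePeel` starts from. [OURS] [cite: Hauser2010, §I (definition of P⁺)] -/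
theorem row_eq_zero_of_short_legal_row_shear {a a' : Fin 4} (haa : a ≠ a') {t : K} (ht : t ≠ 0) (α β : ℕ)
    (G : MvPolynomial (Fin 4) K) (D : ℕ) (κ : Fin 4 → ℕ) (N : ℕ) (hDN : D < N)
    (h : ∀ e : Fin 4 →₀ ℕ, e a + e a' = D → (∀ i, i ≠ a → i ≠ a' → e i = κ i) → e a' < N →
      coeff (e + Finsupp.single a (α + β))
        (shear a (Pi.single a' t) (monomial (Finsupp.single a α + Finsupp.single a' β) (1 : K) * G)) = 0) :
    ∀ e : Fin 4 →₀ ℕ, e a + e a' = D → (∀ i, i ≠ a → i ≠ a' → e i = κ i) → coeff e G = 0 := by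
  refine row_eq_zero_of_short_legal_row haa ht α β G D κ N hDN fun e hD hκ hN => ?_
  rw [← shear_monomial_pair haa t α β, ← shear_mul]
  exact h e hD hκ hN

/-- **The numerology of (RL)**: the level-`ℓ`, `V^i` row has length `D = ℓ + i` and S-legality bound
`N = 2ℓ + 1 − 2i`; it is short exactly when `3i ≤ ℓ`.  So a NON-vanishing legal row has `ℓ + 1 ≤ 3i`. [folklore] -/
theorem level_row_arith {ℓ i : ℕ} : (3 * i ≤ ℓ ↔ ℓ + i < 2 * ℓ + 1 - 2 * i) ∧ (¬ 3 * i ≤ ℓ ↔ ℓ + 1 ≤ 3 * i) := by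
  omega

/-- **(RL) with the numerology plugged in**: under the S-legality vanishing below `N = 2ℓ + 1 − 2i` on the row of
length `D = ℓ + i`, a nonzero coefficient of `G` on that row forces `ℓ + 1 ≤ 3i`. [OURS]
[cite: Hauser2010, §I (definition of P⁺)] -/
theorem level_succ_le_three_mul_of_row_ne_zero {a a' : Fin 4} (haa : a ≠ a') {t : K} (ht : t ≠ 0) (α β : ℕ)
    (G : MvPolynomial (Fin 4) K) (ℓ i : ℕ) (κ : Fin 4 → ℕ)
    (h : ∀ e : Fin 4 →₀ ℕ, e a + e a' = ℓ + i → (∀ i', i' ≠ a → i' ≠ a' → e i' = κ i') →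
      e a' < 2 * ℓ + 1 - 2 * i →
      coeff (e + Finsupp.single a (α + β))
        (shear a (Pi.single a' t) (monomial (Finsupp.single a α + Finsupp.single a' β) (1 : K) * G)) = 0)
    {e₀ : Fin 4 →₀ ℕ} (he₀ : e₀ a + e₀ a' = ℓ + i) (hκ₀ : ∀ i', i' ≠ a → i' ≠ a' → e₀ i' = κ i')
    (hne : coeff e₀ G ≠ 0) : ℓ + 1 ≤ 3 * i := by
  by_contra hlt
  exact hne (row_eq_zero_of_short_legal_row_shear haa ht α β G (ℓ + i) κ (2 * ℓ + 1 - 2 * i) (by omega) h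
    e₀ he₀ hκ₀)

end ResCone

end Summit.ResolutionOfSingularities.ResolutionOfSingularities.Theorems.PIDim4

end
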